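import Literature.AnabelianGeometry.EtaleTheta.Discharge.Sec5Thm57AnchoredFamilyConstAnchorKummerTorsion
import Literature.AnabelianGeometry.EtaleTheta.Discharge.Sec5Thm57GenuineBindersAConstAnchor

/-!
# [EtTh] §5, Theorem 5.7 (CONSTANT-ANCHORED, (C) in TORSION shape): the structural binders re-keyed onto the landed producers —
# `hN` gone, `hinj` ⟸ {`hc₀`, `ht`}, the factorisation `hfac` AT EVERY LEVEL ⟸ {Prop. 3.4 (ii), `ecn`, `hYdd`}, Prop. 4.3 (iii) `hdiff`
# AT EVERY LEVEL ⟸ the level's §5 facts (pp. 303–304, 322, 330–331 / PDF pp. 77–78, 96, 104–105)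

Mochizuki, *The étale theta function …*, Publ. RIMS **45** (2009)
[cite: MochizukiEtTh2009, Thm 5.7 p.329–330 (PDF pp.103–104); Lem 5.8 p.331 (PDF p.105); Prop 4.3 (iii) p.317 (PDF p.91);
Def 3.6 (ii)(iii) p.303 (PDF p.77); §5 p.322 (PDF p.96)].  abc-iut cell, layer L2, node `EtTh:Thm5.7`; abc-iut-L2-lead (gen 6) R732 «(C)
COMPOSER» — ROOT-SIDE half, file (r2) (seat abc-iut-f-123 gen 6).  PROOF-ONLY (0 definitions, 0 new named facts; nothing landed is edited
or restated): the re-keying of abc-iut-w5-d123's p447915 (twinned in `Sec5Thm57GenuineBindersAConstAnchor.lean`) for the torsion-shape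
capstone `…_ofConstAnchored_ofKummerTorsion` (`Sec5Thm57AnchoredFamilyConstAnchorKummerTorsion.lean`), whose (C) column asks, at the levels
of a cofinal set `S`, for Prop. 4.3 (iii) (`hdiff`) and the factorisation of the Galois action on constants (`hfacS`) — both THEOREMS of
the genuine §5 data at EVERY level, exactly as at level `1`:
* `hfac_atLevel_ofConnectedTemperoidYddFamily_of_pushforward` — abc-iut-w4-d008's `ThetaFrobenioid.hfac_ofConnectedTemperoidData_of_pushforward`
  BY NAME at the tower's level `N` (every level of `ofConnectedTemperoidFamily` IS `ofConnectedTemperoidData` over `𝒯.level 1`, definitionally);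
* `biKummerDifferenceMem_atLevel_of_hgc` — Prop. 4.3 (iii) at level `N` from the level's §5 facts
  (`ThetaFrobenioid.facts_ofConnectedTemperoidData`), whose one named input is Lemma 5.8's geometric connectedness `hgc N`;
* `thetaRootPreservedAll_ofConnectedTemperoidYddFamily_ofConstAnchored_ofKummerTorsion_genuine` — the capstone with `hN` GONE, `hinj` ⟸
  {`hc₀`, `ht`}, `hfac₁`/`hfacS` ⟸ {`hP34`, `ecn`, `hYdd`}, `hdiff` ⟸ `hgc`; displayed: `hnd`, `hgc` (ALL levels — its level-1 instance is
  the ONE `ConstantsDictionary` junction binder of p447915; all levels would take a per-level dictionary family), `hK`, `htorsfam` (at the levels of the tower's cofinal index set `E`), the seeds, `hP24`, and the constant-anchored family `hfam`.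
HONEST FRAMING: kernel-checked composition of landed theorems under named hypotheses for data so parametrised (no instance of
`TemperedFrobenioid T₀ (ConnectedPart (BTemp X.Pi)) VD` for an actual curve is constructed); nothing asserts any result of [EtTh]
unconditionally; typed ≠ discharged; no side taken on anything downstream ([IUTchIII] Cor. 3.12 in particular). -/

noncomputable section

namespace Literature.AnabelianGeometry.EtaleTheta

open CategoryTheory Opposite Literature.AlgebraicGeometry.Frobenioids Literature.AnabelianGeometry.SemiGraphs
  Literature.AnabelianGeometry.SemiGraphs.GaloisObjects

universe u₀ v₀ w u₁ v₁

namespace ThetaFrobenioidTower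

section GenuineRekeyed

variable {K : Type u₀} [Field K] {X : SemiGraphs.TemperedArithmeticGroup.{u₀} K} {D₀ : Type u₀} [Category.{v₀} D₀]
  {V : FrdIMonoidStub.{w}} {T₀ : RealifiedDivisorMonoids (D₀ := D₀) V}
  {VD : FrdICatStub.{u₀ + 1, u₀, w} (ConnectedPart (BTemp X.Pi))}
  {tf : TemperedFrobenioid T₀ (ConnectedPart (BTemp X.Pi)) VD} {hZ : tf.monoidType = MonoidType.Z}
  {hP : ∀ A : (ConnectedPart (BTemp X.Pi))ᵒᵖ, IsPerfect (tf.Φ.carrier A)}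
  {NH : Subgroup (Field.absoluteGaloisGroup K) → tf.category → ℕ+ → Prop}
  {E : Set ℕ+} (𝒯 : ThetaEnvTower.{max u₀ w} E) (ιX : 𝒯.PiX ≃ₜ* X.Pi)
  {pullFrac : ∀ {A A' : (BiKummerSetting.mkOfConnectedTemperoidYddTower X tf hZ hP NH 𝒯 ιX).C} (_ : A' ⟶ A),
    (BiKummerSetting.mkOfConnectedTemperoidYddTower X tf hZ hP NH 𝒯 ιX).biratUnits A →
      (BiKummerSetting.mkOfConnectedTemperoidYddTower X tf hZ hP NH 𝒯 ιX).biratUnits A'}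
  {lv : ℕ+}
  {θ : (BiKummerSetting.mkOfConnectedTemperoidYddTower X tf hZ hP NH 𝒯 ιX).biratUnits
    (BiKummerSetting.mkOfConnectedTemperoidYddTower X tf hZ hP NH 𝒯 ιX).Aodot}
  {Bl : (BiKummerSetting.mkOfConnectedTemperoidYddTower X tf hZ hP NH 𝒯 ιX).C}
  {Pl : (BiKummerSetting.mkOfConnectedTemperoidYddTower X tf hZ hP NH 𝒯 ιX).FractionPair θ Bl}
  {Rl : (BiKummerSetting.mkOfConnectedTemperoidYddTower X tf hZ hP NH 𝒯 ιX).NthRoot θ Pl lv pullFrac}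
  (h : ModelFrobenioid.Hypotheses tf.divisorMonoid tf.ratFnFunctor)
  (Q : FrobenioidTheta.ThetaSubquotientStub.{w} (ConnectedPart (BTemp X.Pi))) (odd_l : Odd (lv : ℕ))
  (R : ∀ N : ℕ+, (BiKummerSetting.mkOfConnectedTemperoidYddTower X tf hZ hP NH 𝒯 ιX).NthRoot Rl.root Rl.pair N pullFrac)
  (K' : Type w) [Field K'] {X₀ : ConnectedPart (BTemp X.Pi)}
  (hX₀ : ∀ Y : ConnectedPart (BTemp X.Pi), Subsingleton (Y ⟶ X₀)) (t : ∀ N : ℕ+, (R N).BN.base ⟶ X₀)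
  (c₀ : K'ˣ →* (tf.ratFnFunctor.obj (op X₀))ˣ)
  -- `hinj` RE-KEYED: `c₀` injective and the pull-backs `B(t_N)` injective (abc-iut-w4-d008's `unitsMap_comp_injective`)
  (hc₀ : Function.Injective c₀) (ht : ∀ N : ℕ+, Function.Injective (tf.ratFnFunctor.map (t N).op).hom)
  (hinvc : ∀ (N : ℕ+) (g : Aut (R N).AN.base),
    pull tf.divisorMonoid g.hom (ModelFrobenioid.div (R N).pair.num) = ModelFrobenioid.div (R N).pair.num)
  (hinvp : ∀ (N : ℕ+) (y : 𝒯.PiX), y ∈ 𝒯.PiYdd →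
    pull tf.divisorMonoid ((BiKummerSetting.mkOfConnectedTemperoidYddTower X tf hZ hP NH 𝒯 ιX).galoisSurj (R N).AN.base
      (R N).αData.isGalois (ιX y)).hom (ModelFrobenioid.div (R N).pair.den) = ModelFrobenioid.div (R N).pair.den)
  (α : ∀ {N N' : ℕ+}, (N : ℕ) ∣ N' → ((R N').AN ⟶ (R N).AN))
  (β : ∀ {N N' : ℕ+}, (N : ℕ) ∣ N' → ((R N').BN ⟶ (R N).BN))
  (comm_sCap : ∀ {N N' : ℕ+} (hd : (N : ℕ) ∣ N'), (R N').pair.num ≫ β hd = α hd ≫ (R N).pair.num)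
  (comm_sCup : ∀ {N N' : ℕ+} (hd : (N : ℕ) ∣ N'), (R N').pair.den ≫ β hd = α hd ≫ (R N).pair.den)
  (isIsometry_α : ∀ {N N' : ℕ+} (hd : (N : ℕ) ∣ N'),
    ((BiKummerSetting.mkOfConnectedTemperoidYddTower X tf hZ hP NH 𝒯 ιX).sec5Stub h).pre.IsIsometry (α hd))
  (degFr_α : ∀ {N N' : ℕ+} (hd : (N : ℕ) ∣ N'),
    (((BiKummerSetting.mkOfConnectedTemperoidYddTower X tf hZ hP NH 𝒯 ιX).sec5Stub h).pre.degFr (α hd) : ℕ) * N = N')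
  (isIsometry_β : ∀ {N N' : ℕ+} (hd : (N : ℕ) ∣ N'),
    ((BiKummerSetting.mkOfConnectedTemperoidYddTower X tf hZ hP NH 𝒯 ιX).sec5Stub h).pre.IsIsometry (β hd))
  (degFr_β : ∀ {N N' : ℕ+} (hd : (N : ℕ) ∣ N'),
    (((BiKummerSetting.mkOfConnectedTemperoidYddTower X tf hZ hP NH 𝒯 ιX).sec5Stub h).pre.degFr (β hd) : ℕ) * N = N')
  (baseFrob_α : ∀ {N N' : ℕ+} (hd : (N : ℕ) ∣ N'),
    (BiKummerSetting.mkOfConnectedTemperoidYddTower X tf hZ hP NH 𝒯 ιX).IsOfBaseFrobeniusType (α hd))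

include h hc₀ ht in
/-- **The factorisation `hfac` AT EVERY LEVEL `N ∈ E` (the index set of the `ThetaEnvTower`) of the genuine connected tower** — every `y ∈ Im(Π^tp_Y̲)` acts on `O^×(B_N)` through
`s^⊓-gp_N` like some `h ∈ H_{B_N} = Im(Π^tp_Ÿ̲)` — from Prop. 3.4 (ii) (`hP34`), the [FrdII] Ex. 1.3 (ii) identification `ecn` of
`D → D^cnst` and `hYdd` (abc-iut-w4-d008's `ThetaFrobenioid.hfac_ofConnectedTemperoidData_of_pushforward` BY NAME at level `N`; the level-`1`
instance is p447915's `hfac_atLevelOne_…`). [cite: MochizukiEtTh2009, Lem 5.8 p.331 (PDF p.105); §3 p.298 (PDF p.72); §5 p.322 (PDF p.96)] -/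
theorem hfac_atLevel_ofConnectedTemperoidYddFamily_of_pushforward
    (T : ThetaFrobenioidTower.{w} (BiKummerSetting.mkOfConnectedTemperoidYddTower X tf hZ hP NH 𝒯 ιX).C
      (ConnectedPart (BTemp X.Pi)))
    (hT : T = (ofConnectedTemperoidFamily h Q odd_l R ιX K' (fun N => (Units.map (tf.ratFnFunctor.map (t N).op).hom).comp c₀)
      (fun N => tf.unitsMap_comp_injective (t N) hc₀ (ht N)) hinvc hinvp α β comm_sCap comm_sCup isIsometry_α degFr_α
      isIsometry_β degFr_β baseFrob_α))
    {Dcnst : Type u₁} [Category.{v₁} Dcnst] (cnst : D₀ ⥤ Dcnst) (G : ConnectedPart (BTemp (Field.absoluteGaloisGroup K)) ⥤ Dcnst)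
    (ecn : tf.base ⋙ cnst ≅ QuasiTemperoid.pushforward X.aug.toMonoidHom X.aug_surjective X.augIsOpenMap_holds ⋙ G)
    (hP34 : RealifiedDivisorMonoids.Prop34Cnst T₀ cnst)
    (hYdd : ∀ y : 𝒯.PiX, ∃ k ∈ 𝒯.PiYdd, X.aug (ιX k) = X.aug (ιX y)) {N : ℕ+} (hN : N ∈ E) :
    ∀ y ∈ (T.atLevel N).imPiY, ∃ x ∈ (T.atLevel N).HB, ∀ u ∈ (T.atLevel N).units (T.BN N),
      T.sgpCap N y * u * (T.sgpCap N y)⁻¹ = T.sgpCap N x * u * (T.sgpCap N x)⁻¹ := by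
  subst hT
  exact ThetaFrobenioid.hfac_ofConnectedTemperoidData_of_pushforward (T := 𝒯.level ⟨N, hN⟩) h Q odd_l (R N) ιX K'
    ((Units.map (tf.ratFnFunctor.map (t N).op).hom).comp c₀) (tf.unitsMap_comp_injective (t N) hc₀ (ht N)) (hinvc N)
    (hinvp N) cnst G ecn hP34 hYdd

include hX₀ h hc₀ ht in
/-- **Prop. 4.3 (iii) (`BiKummerDifferenceMem`) AT EVERY LEVEL `N ∈ E` of the genuine connected tower from the level's §5 facts** — the
bi-Kummer difference `s^⊓-gp_N(h)·s^⊔-gp_N(h)⁻¹` lies in `μ_N(B_N)` (`ThetaFrobenioid.facts_ofConnectedTemperoidData` at level `N`;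
Def. 3.6 (iii) for the pulled-back constants is a theorem, abc-iut-w4-d008) — modulo Lemma 5.8's geometric connectedness `hgc N` at
that level. [cite: MochizukiEtTh2009, Prop 4.3 (iii) p.317 (PDF p.91); Lem 5.8 p.331 (PDF p.105)] -/
theorem biKummerDifferenceMem_atLevel_of_hgc
    (T : ThetaFrobenioidTower.{w} (BiKummerSetting.mkOfConnectedTemperoidYddTower X tf hZ hP NH 𝒯 ιX).C
      (ConnectedPart (BTemp X.Pi)))
    (hT : T = (ofConnectedTemperoidFamily h Q odd_l R ιX K' (fun N => (Units.map (tf.ratFnFunctor.map (t N).op).hom).comp c₀)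
      (fun N => tf.unitsMap_comp_injective (t N) hc₀ (ht N)) hinvc hinvp α β comm_sCap comm_sCup isIsometry_α degFr_α
      isIsometry_β degFr_β baseFrob_α)) {N : ℕ+} (hN : N ∈ E)
    (hgcN : ∀ u : (T.atLevel N).units (T.BN N),
      (∀ y ∈ (T.atLevel N).imPiY, T.sgpCap N y * (u : Aut (T.BN N)) * (T.sgpCap N y)⁻¹ = u) →
        (T.atLevel N).unitsToBirat (T.BN N) u ∈ (T.constEmb N).range) :
    (T.atLevel N).BiKummerDifferenceMem := by
  subst hT
  haveI := hX₀
  exact (ThetaFrobenioid.facts_ofConnectedTemperoidData (T := 𝒯.level ⟨N, hN⟩) h Q odd_l (R N) ιX K'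
    ((Units.map (tf.ratFnFunctor.map (t N).op).hom).comp c₀) (tf.unitsMap_comp_injective (t N) hc₀ (ht N)) (hinvc N) (hinvp N)
    (BiKummerSetting.hH_mkOfConnectedTemperoidYddTower X tf hZ hP NH 𝒯 ιX)
    (tf.biratAutModel_unitsMap_comp_apply_of_subsingleton (R N).BN (t N) c₀) hgcN).biKummerDifferenceMem

include hX₀ h hc₀ ht in
/-- **[EtTh] Theorem 5.7 (root level) at ALL levels for the genuine connected tower, CONSTANT-ANCHORED, (C) in TORSION shape, with the
structural binders re-keyed**: `…_ofConstAnchored_ofKummerTorsion` with `hN` GONE (Def. 3.6 (ii)(b)), `hinj` ⟸ {`hc₀`, `ht`}, the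
factorisations `hfac₁` and `hfacS` (every level of `S`) ⟸ {`hP34`, `ecn`, `hYdd`}, and Prop. 4.3 (iii) `hdiff` (every level of `S`) ⟸
`hgc`.  Displayed: (A) `hnd`; `hgc` at ALL levels (Lemma 5.8's geometric connectedness — the level-1 instance is dischargeable by the ONE
`ConstantsDictionary` junction binder, p447915; a per-level dictionary family would discharge all); the seeds `αs`, `βs` with
`hdivcap₁`/`hdivcup₁` and `hP24`; the CONSTANT-ANCHORED coherent family `hfam`; (C) `hK`, `htorsfam` at the levels `N ∈ E` (the cofinal index set of the `ThetaEnvTower`, `S := E`, `hS := 𝒯.cofinal`).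
[cite: MochizukiEtTh2009, Thm 5.7 p.329–330 (PDF pp.103–104); Lem 5.8 p.331 (PDF p.105); Prop 4.3 (iii) p.317 (PDF p.91); Def 3.6 (ii)(iii) p.303 (PDF p.77)] -/
theorem thetaRootPreservedAll_ofConnectedTemperoidYddFamily_ofConstAnchored_ofKummerTorsion_genuine
    (T : ThetaFrobenioidTower.{w} (BiKummerSetting.mkOfConnectedTemperoidYddTower X tf hZ hP NH 𝒯 ιX).C
      (ConnectedPart (BTemp X.Pi)))
    (hT : T = ofConnectedTemperoidFamily h Q odd_l R ιX K' (fun N => (Units.map (tf.ratFnFunctor.map (t N).op).hom).comp c₀)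
      (fun N => tf.unitsMap_comp_injective (t N) hc₀ (ht N)) hinvc hinvp α β comm_sCap comm_sCup isIsometry_α degFr_α
      isIsometry_β degFr_β baseFrob_α)
    -- (A), residual: print's standing hypothesis "`Φ` non-dilating" (Thm. 3.7 (ii) / Cor. 3.8)
    (hnd : IsNonDilatingOn tf.divisorMonoid)
    -- (A) Lemma 5.8's geometric connectedness at EVERY level (displayed; level 1 ⟸ `ConstantsDictionary`, p447915)
    (hgc : ∀ (N : ℕ+) (u : (T.atLevel N).units (T.BN N)),
      (∀ y ∈ (T.atLevel N).imPiY, T.sgpCap N y * (u : Aut (T.BN N)) * (T.sgpCap N y)⁻¹ = u) →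
        (T.atLevel N).unitsToBirat (T.BN N) u ∈ (T.constEmb N).range)
    (Ψ : (BiKummerSetting.mkOfConnectedTemperoidYddTower X tf hZ hP NH 𝒯 ιX).C ≌
      (BiKummerSetting.mkOfConnectedTemperoidYddTower X tf hZ hP NH 𝒯 ιX).C)
    -- (A) `hfac₁` RE-KEYED: Prop. 3.4 (ii), the identification `D → D₀ → D^cnst ≅ aug_* ⋙ G`, and `hYdd`
    {Dcnst : Type u₁} [Category.{v₁} Dcnst] (cnst : D₀ ⥤ Dcnst) (G : ConnectedPart (BTemp (Field.absoluteGaloisGroup K)) ⥤ Dcnst)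
    (ecn : tf.base ⋙ cnst ≅ QuasiTemperoid.pushforward X.aug.toMonoidHom X.aug_surjective X.augIsOpenMap_holds ⋙ G)
    (hP34 : RealifiedDivisorMonoids.Prop34Cnst T₀ cnst)
    (hYdd : ∀ y : 𝒯.PiX, ∃ k ∈ 𝒯.PiYdd, X.aug (ιX k) = X.aug (ιX y))
    -- the seeds of the anchor at the first root [Thm. 5.10 (i)] and the inputs of abc-iut-w5-d245's producer
    (αs : Ψ.functor.obj (T.AN 1) ≅ T.AN 1) (βs : Ψ.functor.obj (T.BN 1) ≅ T.BN 1)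
    (hdivcap₁ : T.pre.div (αs.inv ≫ Ψ.functor.map (T.sCap 1) ≫ βs.hom) = T.pre.div (T.sCap 1))
    (hdivcup₁ : T.pre.div (αs.inv ≫ Ψ.functor.map (T.sCup 1) ≫ βs.hom) = T.pre.div (T.sCup 1))
    (hP24 : ∀ γ : 𝒯.PiX ≃ₜ* 𝒯.PiX, 𝒯.PiYdd.map γ.toMulEquiv.toMonoidHom = 𝒯.PiYdd)
    -- the coherent family, for every normalised anchor WHOSE DISCREPANCY UNIT IS A GIVEN CONSTANT `c` (abc-iut-f-121's p438241 output shape)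
    (hfam : ∀ (α₁ : Ψ.functor.obj (T.AN 1) ≅ T.AN 1) (β₁ : Ψ.functor.obj (T.BN 1) ≅ T.BN 1) (u₁ : Aut (T.BN 1))
      (hu₁ : u₁ ∈ (T.atLevel 1).units (T.BN 1)),
      α₁.inv ≫ Ψ.functor.map (T.sCap 1) ≫ β₁.hom = T.sCap 1 →
      α₁.inv ≫ Ψ.functor.map (T.sCup 1) ≫ β₁.hom = T.sCup 1 ≫ u₁.hom →
      ∀ c : T.Kˣ, (T.atLevel 1).unitsToBirat (T.BN 1) ⟨u₁, hu₁⟩ = T.constEmb 1 c →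
        ∀ N : ℕ+, ∃ (a : Ψ.functor.obj (T.AN N) ≅ T.AN N) (b : Ψ.functor.obj (T.BN N) ≅ T.BN N) (w : Aut (T.BN N)),
          w ∈ (T.atLevel N).units (T.BN N) ∧
          a.inv ≫ Ψ.functor.map (T.sCap N) ≫ b.hom = T.sCap N ∧
          a.inv ≫ Ψ.functor.map (T.sCup N) ≫ b.hom = T.sCup N ≫ w.hom ∧
          a.inv ≫ Ψ.functor.map (T.α (one_dvd_level N)) ≫ α₁.hom = T.α (one_dvd_level N) ∧
          b.inv ≫ Ψ.functor.map (T.β (one_dvd_level N)) ≫ β₁.hom = T.β (one_dvd_level N))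
    -- (C) in TORSION shape: `⋂_N (K^×)^N = 1` and, at every level of the tower's (cofinal) index set `E`, the torsion of the Kummer cocycles of the discrepancies of every
    -- family member coherent with the CONSTANT normalised anchor (abc-iut-w6-d049's `htors`, quantified over the family)
    (hK : ∀ x : T.Kˣ, (∀ N : ℕ+, ∃ d : T.Kˣ, d ^ (N : ℕ) = x) → x = 1)
    (htorsfam : ∀ (α₁ : Ψ.functor.obj (T.AN 1) ≅ T.AN 1) (β₁ : Ψ.functor.obj (T.BN 1) ≅ T.BN 1) (u₁ : Aut (T.BN 1))
      (hu₁ : u₁ ∈ (T.atLevel 1).units (T.BN 1)),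
      α₁.inv ≫ Ψ.functor.map (T.sCap 1) ≫ β₁.hom = T.sCap 1 →
      α₁.inv ≫ Ψ.functor.map (T.sCup 1) ≫ β₁.hom = T.sCup 1 ≫ u₁.hom →
      ∀ c : T.Kˣ, (T.atLevel 1).unitsToBirat (T.BN 1) ⟨u₁, hu₁⟩ = T.constEmb 1 c →
      ∀ N ∈ E, ∀ (a : Ψ.functor.obj (T.AN N) ≅ T.AN N) (b : Ψ.functor.obj (T.BN N) ≅ T.BN N) (w : Aut (T.BN N)),
        w ∈ (T.atLevel N).units (T.BN N) →
        a.inv ≫ Ψ.functor.map (T.sCap N) ≫ b.hom = T.sCap N →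
        a.inv ≫ Ψ.functor.map (T.sCup N) ≫ b.hom = T.sCup N ≫ w.hom →
        a.inv ≫ Ψ.functor.map (T.α (one_dvd_level N)) ≫ α₁.hom = T.α (one_dvd_level N) →
        b.inv ≫ Ψ.functor.map (T.β (one_dvd_level N)) ≫ β₁.hom = T.β (one_dvd_level N) →
          ∃ u ∈ (T.atLevel N).muTorsion (T.BN N) N, ∀ k : (T.atLevel N).PiYdd,
            T.sgpCup N ((T.atLevel N).rhoYdd k) * w ^ (2 * T.l) * (T.sgpCup N ((T.atLevel N).rhoYdd k))⁻¹ * (w ^ (2 * T.l))⁻¹ =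
              T.sgpCup N ((T.atLevel N).rhoYdd k) * u * (T.sgpCup N ((T.atLevel N).rhoYdd k))⁻¹ * u⁻¹) :
    T.ThetaRootPreservedAll Ψ :=
  thetaRootPreservedAll_ofConnectedTemperoidYddFamily_ofConstAnchored_ofKummerTorsion (𝒯 := 𝒯) (ιX := ιX) (h := h) (Q := Q)
    (odd_l := odd_l) (R := R) (K' := K') (hX₀ := hX₀) (t := t) (c₀ := c₀)
    (hinj := fun N => tf.unitsMap_comp_injective (t N) hc₀ (ht N)) (hinvc := hinvc) (hinvp := hinvp) (α := α) (β := β)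
    (comm_sCap := comm_sCap) (comm_sCup := comm_sCup) (isIsometry_α := isIsometry_α) (degFr_α := degFr_α)
    (isIsometry_β := isIsometry_β) (degFr_β := degFr_β) (baseFrob_α := baseFrob_α) (T := T) (hT := hT) (hnd := hnd)
    (hN := hN_mkOfConnectedTemperoidYddTower 𝒯 ιX) (hgc := hgc) (Ψ := Ψ)
    (hfac₁ := hfac_atLevel_ofConnectedTemperoidYddFamily_of_pushforward 𝒯 ιX h Q odd_l R K' t c₀ hc₀ ht hinvc hinvp α β
      comm_sCap comm_sCup isIsometry_α degFr_α isIsometry_β degFr_β baseFrob_α T hT cnst G ecn hP34 hYdd 𝒯.one_mem)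
    (αs := αs) (βs := βs) (hdivcap₁ := hdivcap₁) (hdivcup₁ := hdivcup₁) (hP24 := hP24) (hfam := hfam) (hK := hK) (hS := 𝒯.cofinal)
    (hdiff := fun N hN => biKummerDifferenceMem_atLevel_of_hgc 𝒯 ιX h Q odd_l R K' hX₀ t c₀ hc₀ ht hinvc hinvp α β comm_sCap comm_sCup
      isIsometry_α degFr_α isIsometry_β degFr_β baseFrob_α T hT hN (hgc N))
    (hfacS := fun _ hN => hfac_atLevel_ofConnectedTemperoidYddFamily_of_pushforward 𝒯 ιX h Q odd_l R K' t c₀ hc₀ ht hinvc hinvp α β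
      comm_sCap comm_sCup isIsometry_α degFr_α isIsometry_β degFr_β baseFrob_α T hT cnst G ecn hP34 hYdd hN)
    (htorsfam := htorsfam)

end GenuineRekeyed

end ThetaFrobenioidTower

end Literature.AnabelianGeometry.EtaleTheta

end
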